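import Summits.MatrixMultiplication.OmegaCensus.SmallFormats.MatMul22nRankGF7Slack5Search
import HarnessLib

/-!
# ω-census family (a): replay of the slack-5 search certificate, CHECK B part 2 of 8 (classes `18 ≤ c < 90`)

Cell `pub-omega` (unit `pub-omega-tensor-g16`), topic `Summits/MatrixMultiplication/OmegaCensus` (sub-folder `SmallFormats`).
Framing (verbatim): lottery ticket; floor = certified bounds/negative ranges. HONEST FRAMING: machine-generated kernel replay
(`pub-omega-tensor-g16/code/gen5_runs.py`): `search5 c = true` for the classes `18 ≤ c < 90` (4085 search nodes in 3 `decide`s).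
Meaning (`search5_sound`, `MatMul22nRankGF7Slack5SearchSound`): no LP-tight point of slack 5 has one of these representatives as torus-0 column.
Nothing here is progress on `ω`.
-/

namespace Summit.MatrixMultiplication.OmegaCensus.SmallFormats

set_option Elab.async false

set_option maxRecDepth 100000 in
set_option maxHeartbeats 400000000 in
/-- Classes `18 ≤ c < 46` (1428 nodes). -/
theorem search5_ok_18_46 : ∀ c : Fin 656, 18 ≤ c.val → c.val < 46 → search5 c.val = true := by decide +kernel

set_option maxRecDepth 100000 in
set_option maxHeartbeats 400000000 in
/-- Classes `46 ≤ c < 81` (1497 nodes). -/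
theorem search5_ok_46_81 : ∀ c : Fin 656, 46 ≤ c.val → c.val < 81 → search5 c.val = true := by decide +kernel

set_option maxRecDepth 100000 in
set_option maxHeartbeats 400000000 in
/-- Classes `81 ≤ c < 90` (1160 nodes). -/
theorem search5_ok_81_90 : ∀ c : Fin 656, 81 ≤ c.val → c.val < 90 → search5 c.val = true := by decide +kernel

/-- CHECK B for the classes `18 ≤ c < 90`. -/
theorem search5_run_2 : ∀ c : Fin 656, 18 ≤ c.val → c.val < 90 → search5 c.val = true := by
  intro c hlo hhi
  by_cases h46 : c.val < 46
  · exact search5_ok_18_46 c (by omega) h46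
  by_cases h81 : c.val < 81
  · exact search5_ok_46_81 c (by omega) h81
  exact search5_ok_81_90 c (by omega) hhi

end Summit.MatrixMultiplication.OmegaCensus.SmallFormats
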